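import Summits.NavierStokesRegularity.NavierStokesRegularity.Theses.OddMorawetz
import Literature.Analysis.FluidPDE.WholeSpaceIBPIntegrable
import Literature.Analysis.FluidPDE.PeriodicCylinderGaussGreen

/-!
# `stub_fluxTransfer`: a pointwise certificate integrates (crux `OddMorawetzLocal`, line `registered`)

Stub `stub_fluxTransfer` of the birth skeleton of the crux
`Summit.NavierStokesRegularity.NavierStokesRegularity.Theses.OddMorawetz.OddMorawetzLocal`
(item `stmt-NavierStokesRegularity-1376`): pure calculus on `ℝ³`.

Given smooth `m σ Φ`, a Schwartz field `v`, a smooth field `b` whose derivatives of order `≤ 4` decay like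
`(1+|x|)⁻⁴`, and the pointwise identity `−Dm(Jv x)[Jb x] = σ(J₄v x, J₄b x) + div_x Φ(Jv, Jb)(x)` (`J`, `J₄` the
3-jet and 4-jet maps, pinned by their defining equations), the function `x ↦ σ(J₄v x, J₄b x)` is integrable and
`−∫ Dm(Jv)[Jb] = ∫ σ(J₄v, J₄b)`.

Proof. The 3-jets `Jv`, `Jb` and their first derivatives are `O((1+|x|)⁻⁴)` (Schwartz seminorms for `v`, the
hypothesis for `b`; `‖D(Dⁿu)(x)‖ = ‖Dⁿ⁺¹u(x)‖`). All jet values lie in a closed ball of the jet space, which is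
compact because the jet spaces are finite-dimensional, so `Dm` and `DΦ` are bounded there. Hence
`x ↦ Dm(Jv x)[Jb x]` is `O((1+|x|)⁻⁴)` and integrable (`4 > 3 = dim`), and so are `w := Φ(Jv, Jb) − Φ(0)` (mean
value inequality) and `div w` (`|div| ≤ 3‖D·‖`, the tree's `abs_divergence_le`, and the chain rule). The whole-space divergence theorem in `L¹` form
(`Literature.Analysis.FluidPDE.integral_divergence_eq_zero_of_integrable`) gives `∫ div w = 0`, and
`div w = div Φ(Jv, Jb)` pointwise; integrating the identity finishes (the `σ`-term is `L¹` as a difference of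
two `L¹` functions).

Helpers (namespace `…Theorems.StubFluxTransfer`): finite-dimensionality of `ℝ³ [×n]→L[ℝ] ℝ³`, integrability of
`(1+|x|)⁻⁴` on `ℝ³`, jet bounds, the pairing lemma and the flux lemma.
No definitions, no named facts; everything proved.
-/

noncomputable section

-- single-conjunct summit: `Summit.<Summit>.<Problem>` repeats the name by the D-0017 layout
set_option linter.dupNamespace false

open MeasureTheory Metric
open Literature.Analysis.FluidPDE

namespace Summit.NavierStokesRegularity.NavierStokesRegularity.Theorems

namespace StubFluxTransfer

/-- The continuous `n`-multilinear maps on `ℝ³` form a finite-dimensional space: they embed linearly into the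
finite-dimensional space of all multilinear maps (Mathlib `Module.Finite.multilinearMap`). -/
theorem finiteDimensional_continuousMultilinearMap (n : ℕ) : FiniteDimensional ℝ ((EuclideanSpace ℝ (Fin 3)) [×n]→L[ℝ] (EuclideanSpace ℝ (Fin 3))) :=
  FiniteDimensional.of_injective
    (ContinuousMultilinearMap.toMultilinearMapLinear :
      ((EuclideanSpace ℝ (Fin 3)) [×n]→L[ℝ] (EuclideanSpace ℝ (Fin 3))) →ₗ[ℝ] MultilinearMap ℝ (fun _ : Fin n => (EuclideanSpace ℝ (Fin 3))) (EuclideanSpace ℝ (Fin 3)))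
    fun _ _ h => ContinuousMultilinearMap.toMultilinearMap_injective h

/-- `(1 + |x|)⁻⁴` is integrable on `ℝ³` (Mathlib `integrable_one_add_norm`: the exponent `4` exceeds
`dim ℝ³ = 3`). -/
theorem integrable_inv_one_add_norm_pow : Integrable fun x : (EuclideanSpace ℝ (Fin 3)) => ((1 + ‖x‖) ^ 4)⁻¹ := by
  have h : Integrable fun x : (EuclideanSpace ℝ (Fin 3)) => (1 + ‖x‖) ^ (-(4 : ℝ)) := by
    refine integrable_one_add_norm ?_
    rw [finrank_euclideanSpace, Fintype.card_fin]
    norm_num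
  refine h.congr (Filter.Eventually.of_forall fun x => ?_)
  show (1 + ‖x‖) ^ (-(4 : ℝ)) = ((1 + ‖x‖) ^ 4)⁻¹
  rw [Real.rpow_neg (by positivity), Real.rpow_ofNat]

/-- A decay bound `‖g x‖ ≤ K (1+|x|)⁻⁴` forces `0 ≤ K` (evaluate at `x = 0`) and the uniform bound `‖g x‖ ≤ K`. -/
theorem nonneg_of_decay {α : Type*} [SeminormedAddCommGroup α] {g : (EuclideanSpace ℝ (Fin 3)) → α} {K : ℝ}
    (hg : ∀ x, ‖g x‖ ≤ K * ((1 + ‖x‖) ^ 4)⁻¹) : 0 ≤ K ∧ ∀ x, ‖g x‖ ≤ K := by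
  have hK : 0 ≤ K := by
    have h := hg 0
    simp only [norm_zero, add_zero, one_pow, inv_one, mul_one] at h
    exact (norm_nonneg _).trans h
  refine ⟨hK, fun x => (hg x).trans ?_⟩
  refine mul_le_of_le_one_right hK (inv_le_one_of_one_le₀ ?_)
  exact one_le_pow₀ (le_add_of_nonneg_right (norm_nonneg x))

/-- **Jet bounds.** For a smooth field `u` on `ℝ³` whose derivatives of order `≤ 4` satisfy
`(1+|x|)⁴ ‖Dⁿu(x)‖ ≤ A`, the 3-jet map `x ↦ (u x, Du x, D²u x, D³u x)` is `C¹`, and it and its derivative are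
bounded in norm by `A (1+|x|)⁻⁴` (sup norm on the product; `‖D(Dⁿu)(x)‖ = ‖Dⁿ⁺¹u(x)‖`). -/
theorem jet_bounds {u : (EuclideanSpace ℝ (Fin 3)) → (EuclideanSpace ℝ (Fin 3))} (hu : ContDiff ℝ (⊤ : ℕ∞) u) {A : ℝ}
    (hA : ∀ n : ℕ, n ≤ 4 → ∀ x : (EuclideanSpace ℝ (Fin 3)), (1 + ‖x‖) ^ 4 * ‖iteratedFDeriv ℝ n u x‖ ≤ A) :
    ContDiff ℝ 1 (fun x => (u x, iteratedFDeriv ℝ 1 u x, iteratedFDeriv ℝ 2 u x,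
        iteratedFDeriv ℝ 3 u x)) ∧
      (∀ x, ‖(u x, iteratedFDeriv ℝ 1 u x, iteratedFDeriv ℝ 2 u x, iteratedFDeriv ℝ 3 u x)‖ ≤
        A * ((1 + ‖x‖) ^ 4)⁻¹) ∧
      ∀ x, ‖fderiv ℝ (fun x => (u x, iteratedFDeriv ℝ 1 u x, iteratedFDeriv ℝ 2 u x,
        iteratedFDeriv ℝ 3 u x)) x‖ ≤ A * ((1 + ‖x‖) ^ 4)⁻¹ := by
  have hA' : ∀ n : ℕ, n ≤ 4 → ∀ x : (EuclideanSpace ℝ (Fin 3)), ‖iteratedFDeriv ℝ n u x‖ ≤ A * ((1 + ‖x‖) ^ 4)⁻¹ := by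
    intro n hn x
    rw [le_mul_inv_iff₀' (by positivity)]
    exact hA n hn x
  have h5 : ContDiff ℝ 5 u := contDiff_infty.1 hu 5
  have hcd : ∀ i : ℕ, i ≤ 4 → ContDiff ℝ 1 (iteratedFDeriv ℝ i u) := fun i hi =>
    h5.iteratedFDeriv_right (by exact_mod_cast (show 1 + i ≤ 5 by omega))
  have hu1 : ContDiff ℝ 1 u := h5.of_le (by norm_num)
  refine ⟨hu1.prodMk ((hcd 1 (by norm_num)).prodMk ((hcd 2 (by norm_num)).prodMk (hcd 3 (by norm_num)))),
    fun x => ?_, fun x => ?_⟩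
  · simp only [Prod.norm_mk, max_le_iff]
    refine ⟨?_, hA' 1 (by norm_num) x, hA' 2 (by norm_num) x, hA' 3 (by norm_num) x⟩
    rw [← norm_iteratedFDeriv_zero (𝕜 := ℝ) (f := u) (x := x)]
    exact hA' 0 (by norm_num) x
  · have h0 : HasFDerivAt u (fderiv ℝ u x) x := (hu1.differentiable one_ne_zero x).hasFDerivAt
    have hi : ∀ i : ℕ, i ≤ 4 →
        HasFDerivAt (iteratedFDeriv ℝ i u) (fderiv ℝ (iteratedFDeriv ℝ i u) x) x :=
      fun i hi => ((hcd i hi).differentiable one_ne_zero x).hasFDerivAt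
    rw [(h0.prodMk ((hi 1 (by norm_num)).prodMk ((hi 2 (by norm_num)).prodMk
      (hi 3 (by norm_num))))).fderiv]
    simp only [ContinuousLinearMap.opNorm_prod, Prod.norm_mk, max_le_iff, norm_fderiv_iteratedFDeriv]
    refine ⟨?_, hA' 2 (by norm_num) x, hA' 3 (by norm_num) x, hA' 4 (by norm_num) x⟩
    rw [← norm_iteratedFDeriv_zero (𝕜 := ℝ) (f := fderiv ℝ u) (x := x), norm_iteratedFDeriv_fderiv]
    exact hA' 1 (by norm_num) x

/-- **Pairing lemma.** On a finite-dimensional space `P`, if `jv : ℝ³ → P` is continuous with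
`‖jv x‖ ≤ Kᵥ (1+|x|)⁻⁴`, `jb : ℝ³ → P` is continuous with `‖jb x‖ ≤ K_b (1+|x|)⁻⁴` and `m : P → ℝ` is `C¹`, then
`x ↦ Dm(jv x)[jb x]` is integrable: `Dm` is bounded on the compact closed ball containing the values of `jv`. -/
theorem integrable_pairing {P : Type*} [NormedAddCommGroup P] [NormedSpace ℝ P] [FiniteDimensional ℝ P]
    {jv jb : (EuclideanSpace ℝ (Fin 3)) → P} {Kv Kb : ℝ} (hjv : Continuous jv) (hjb : Continuous jb)
    (hv0 : ∀ x, ‖jv x‖ ≤ Kv * ((1 + ‖x‖) ^ 4)⁻¹) (hb0 : ∀ x, ‖jb x‖ ≤ Kb * ((1 + ‖x‖) ^ 4)⁻¹)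
    {m : P → ℝ} (hm : ContDiff ℝ 1 m) :
    Integrable fun x => fderiv ℝ m (jv x) (jb x) := by
  have hmem : ∀ x, jv x ∈ closedBall (0 : P) Kv := fun x => by
    rw [mem_closedBall, dist_zero_right]
    exact (nonneg_of_decay hv0).2 x
  obtain ⟨M, hM⟩ := (isCompact_closedBall (0 : P) Kv).exists_bound_of_continuousOn
    (hm.continuous_fderiv one_ne_zero).continuousOn
  have hM0 : 0 ≤ M := (norm_nonneg _).trans (hM _ (hmem 0))
  have hc : Continuous fun x => fderiv ℝ m (jv x) (jb x) :=
    ((hm.continuous_fderiv one_ne_zero).comp hjv).clm_apply hjb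
  refine (integrable_inv_one_add_norm_pow.const_mul (M * Kb)).mono' hc.aestronglyMeasurable
    (Filter.Eventually.of_forall fun x => ?_)
  calc ‖fderiv ℝ m (jv x) (jb x)‖ ≤ ‖fderiv ℝ m (jv x)‖ * ‖jb x‖ := ContinuousLinearMap.le_opNorm _ _
    _ ≤ M * (Kb * ((1 + ‖x‖) ^ 4)⁻¹) := mul_le_mul (hM _ (hmem x)) (hb0 x) (norm_nonneg _) hM0
    _ = M * Kb * ((1 + ‖x‖) ^ 4)⁻¹ := by ring

/-- **Flux lemma.** On a finite-dimensional space `Q`, if `g : ℝ³ → Q` is `C¹` with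
`‖g x‖, ‖Dg x‖ ≤ K (1+|x|)⁻⁴` and `Φ : Q → ℝ³` is `C¹`, then `div (Φ ∘ g)` is integrable on `ℝ³` with integral
zero: `w := Φ ∘ g − Φ 0` has the same divergence, `‖w‖ ≤ L ‖g‖` (mean value inequality, `L` a bound for `DΦ` on
the closed ball of radius `K`) and `|div w| ≤ 3 L ‖Dg‖` are `O((1+|x|)⁻⁴)`, hence integrable, and the whole-space
divergence theorem `integral_divergence_eq_zero_of_integrable` applies. -/
theorem flux {Q : Type*} [NormedAddCommGroup Q] [NormedSpace ℝ Q] [FiniteDimensional ℝ Q]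
    {g : (EuclideanSpace ℝ (Fin 3)) → Q} {K : ℝ} (hg : ContDiff ℝ 1 g)
    (hg0 : ∀ x, ‖g x‖ ≤ K * ((1 + ‖x‖) ^ 4)⁻¹) (hg1 : ∀ x, ‖fderiv ℝ g x‖ ≤ K * ((1 + ‖x‖) ^ 4)⁻¹)
    {Φ : Q → (EuclideanSpace ℝ (Fin 3))} (hΦ : ContDiff ℝ 1 Φ) :
    Integrable (fun x => VectorCalculus.divergence (fun y => Φ (g y)) x) ∧
      ∫ x, VectorCalculus.divergence (fun y => Φ (g y)) x = 0 := by
  obtain ⟨hK, hgK'⟩ := nonneg_of_decay hg0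
  have hgK : ∀ x, g x ∈ closedBall (0 : Q) K := fun x => by
    rw [mem_closedBall, dist_zero_right]
    exact hgK' x
  obtain ⟨L, hL⟩ := (isCompact_closedBall (0 : Q) K).exists_bound_of_continuousOn
    (hΦ.continuous_fderiv one_ne_zero).continuousOn
  have hL0 : 0 ≤ L := (norm_nonneg _).trans (hL _ (hgK 0))
  have hΦd : Differentiable ℝ Φ := hΦ.differentiable one_ne_zero
  have hgd : Differentiable ℝ g := hg.differentiable one_ne_zero
  -- the shifted field `w = Φ ∘ g - Φ 0`: same divergence, `C¹`, integrable
  have hw1 : ContDiff ℝ 1 fun y => Φ (g y) - Φ 0 := (hΦ.comp hg).sub contDiff_const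
  have hdivw : ∀ x, VectorCalculus.divergence (fun y => Φ (g y) - Φ 0) x =
      VectorCalculus.divergence (fun y => Φ (g y)) x := fun x => by
    simp only [VectorCalculus.divergence, fderiv_sub_const]
  have hwb : ∀ y, ‖Φ (g y) - Φ 0‖ ≤ L * K * ((1 + ‖y‖) ^ 4)⁻¹ := fun y => by
    have h := (convex_closedBall (0 : Q) K).norm_image_sub_le_of_norm_fderiv_le (𝕜 := ℝ) (f := Φ)
      (fun q _ => hΦd q) hL (mem_closedBall_self hK) (hgK y)
    rw [sub_zero] at h
    calc ‖Φ (g y) - Φ 0‖ ≤ L * ‖g y‖ := h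
      _ ≤ L * (K * ((1 + ‖y‖) ^ 4)⁻¹) := mul_le_mul_of_nonneg_left (hg0 y) hL0
      _ = L * K * ((1 + ‖y‖) ^ 4)⁻¹ := by ring
  have hwi : Integrable fun y => Φ (g y) - Φ 0 :=
    (integrable_inv_one_add_norm_pow.const_mul (L * K)).mono' hw1.continuous.aestronglyMeasurable
      (Filter.Eventually.of_forall hwb)
  -- the divergence of `Φ ∘ g`: continuous and `O((1+|x|)⁻⁴)`, hence integrable
  have hDb : ∀ x, ‖VectorCalculus.divergence (fun y => Φ (g y)) x‖ ≤
      3 * (L * K) * ((1 + ‖x‖) ^ 4)⁻¹ := by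
    intro x
    rw [Real.norm_eq_abs]
    refine (abs_divergence_le _ x).trans ?_
    rw [fderiv_fun_comp x (hΦd (g x)) (hgd x)]
    calc 3 * ‖(fderiv ℝ Φ (g x)).comp (fderiv ℝ g x)‖
        ≤ 3 * (‖fderiv ℝ Φ (g x)‖ * ‖fderiv ℝ g x‖) :=
          mul_le_mul_of_nonneg_left (ContinuousLinearMap.opNorm_comp_le _ _) (by norm_num)
      _ ≤ 3 * (L * (K * ((1 + ‖x‖) ^ 4)⁻¹)) :=
          mul_le_mul_of_nonneg_left (mul_le_mul (hL _ (hgK x)) (hg1 x) (norm_nonneg _) hL0)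
            (by norm_num)
      _ = 3 * (L * K) * ((1 + ‖x‖) ^ 4)⁻¹ := by ring
  have hDc : Continuous fun x => VectorCalculus.divergence (fun y => Φ (g y)) x := by
    have hc : Continuous fun x => fderiv ℝ (fun y => Φ (g y)) x :=
      (hΦ.comp hg).continuous_fderiv one_ne_zero
    simp_rw [divergence_eq_sum_inner_fderiv (EuclideanSpace.basisFun (Fin 3) ℝ)]
    exact continuous_finsetSum _ fun i _ => continuous_const.inner (hc.clm_apply continuous_const)
  have hDi : Integrable fun x => VectorCalculus.divergence (fun y => Φ (g y)) x :=
    (integrable_inv_one_add_norm_pow.const_mul (3 * (L * K))).mono' hDc.aestronglyMeasurable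
      (Filter.Eventually.of_forall hDb)
  refine ⟨hDi, ?_⟩
  have hfun : (fun x => VectorCalculus.divergence (fun y => Φ (g y) - Φ 0) x) =
      fun x => VectorCalculus.divergence (fun y => Φ (g y)) x := funext hdivw
  have h0 := integral_divergence_eq_zero_of_integrable hw1 hwi (by rw [hfun]; exact hDi)
  rw [hfun] at h0
  exact h0

end StubFluxTransfer

/-- **`stub_fluxTransfer`** (stub 3 of the birth skeleton of the crux `OddMorawetzLocal`; calculus on `ℝ³`).
Let `J`, `J4` be the 3-jet and 4-jet maps (pinned by their defining equations), `m σ Φ` smooth, `σ ≥ 0`, `v` a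
Schwartz field and `b` a smooth field with `(1+|x|)⁴ ‖Dⁿb(x)‖ ≤ C` for `n ≤ 4`. If pointwise
`−Dm(Jv x)[Jb x] = σ(J4 v x, J4 b x) + div_x Φ(Jv, Jb)(x)`, then `x ↦ σ(J4 v x, J4 b x)` is integrable and
`−∫ Dm(Jv)[Jb] = ∫ σ(J4 v, J4 b)`. Proof: `x ↦ Dm(Jv x)[Jb x]` and `div Φ(Jv, Jb)` are `O((1+|x|)⁻⁴)`, hence
integrable (`StubFluxTransfer.integrable_pairing`, `StubFluxTransfer.flux`), the latter with integral zero by the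
whole-space divergence theorem applied to `Φ(Jv, Jb) − Φ(0)`; integrate the identity. -/
theorem stub_fluxTransfer :
    ∀ (J : (EuclideanSpace ℝ (Fin 3) → EuclideanSpace ℝ (Fin 3)) → EuclideanSpace ℝ (Fin 3) → EuclideanSpace ℝ (Fin 3) × (EuclideanSpace ℝ (Fin 3) [×1]→L[ℝ] EuclideanSpace ℝ (Fin 3)) × (EuclideanSpace ℝ (Fin 3) [×2]→L[ℝ] EuclideanSpace ℝ (Fin 3)) × (EuclideanSpace ℝ (Fin 3) [×3]→L[ℝ] EuclideanSpace ℝ (Fin 3)))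
      (J4 : (EuclideanSpace ℝ (Fin 3) → EuclideanSpace ℝ (Fin 3)) → EuclideanSpace ℝ (Fin 3) → EuclideanSpace ℝ (Fin 3) × (EuclideanSpace ℝ (Fin 3) [×1]→L[ℝ] EuclideanSpace ℝ (Fin 3)) × (EuclideanSpace ℝ (Fin 3) [×2]→L[ℝ] EuclideanSpace ℝ (Fin 3)) × (EuclideanSpace ℝ (Fin 3) [×3]→L[ℝ] EuclideanSpace ℝ (Fin 3)) × (EuclideanSpace ℝ (Fin 3) [×4]→L[ℝ] EuclideanSpace ℝ (Fin 3))),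
      (∀ v x, J v x = (v x, iteratedFDeriv ℝ 1 v x, iteratedFDeriv ℝ 2 v x, iteratedFDeriv ℝ 3 v x)) →
      (∀ v x, J4 v x = (v x, iteratedFDeriv ℝ 1 v x, iteratedFDeriv ℝ 2 v x, iteratedFDeriv ℝ 3 v x,
        iteratedFDeriv ℝ 4 v x)) →
      ∀ (m : EuclideanSpace ℝ (Fin 3) × (EuclideanSpace ℝ (Fin 3) [×1]→L[ℝ] EuclideanSpace ℝ (Fin 3)) × (EuclideanSpace ℝ (Fin 3) [×2]→L[ℝ] EuclideanSpace ℝ (Fin 3)) × (EuclideanSpace ℝ (Fin 3) [×3]→L[ℝ] EuclideanSpace ℝ (Fin 3)) → ℝ)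
        (σ : (EuclideanSpace ℝ (Fin 3) × (EuclideanSpace ℝ (Fin 3) [×1]→L[ℝ] EuclideanSpace ℝ (Fin 3)) × (EuclideanSpace ℝ (Fin 3) [×2]→L[ℝ] EuclideanSpace ℝ (Fin 3)) × (EuclideanSpace ℝ (Fin 3) [×3]→L[ℝ] EuclideanSpace ℝ (Fin 3)) × (EuclideanSpace ℝ (Fin 3) [×4]→L[ℝ] EuclideanSpace ℝ (Fin 3))) × (EuclideanSpace ℝ (Fin 3) × (EuclideanSpace ℝ (Fin 3) [×1]→L[ℝ] EuclideanSpace ℝ (Fin 3)) × (EuclideanSpace ℝ (Fin 3) [×2]→L[ℝ] EuclideanSpace ℝ (Fin 3)) × (EuclideanSpace ℝ (Fin 3) [×3]→L[ℝ] EuclideanSpace ℝ (Fin 3)) × (EuclideanSpace ℝ (Fin 3) [×4]→L[ℝ] EuclideanSpace ℝ (Fin 3))) → ℝ)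
        (Φ : (EuclideanSpace ℝ (Fin 3) × (EuclideanSpace ℝ (Fin 3) [×1]→L[ℝ] EuclideanSpace ℝ (Fin 3)) × (EuclideanSpace ℝ (Fin 3) [×2]→L[ℝ] EuclideanSpace ℝ (Fin 3)) × (EuclideanSpace ℝ (Fin 3) [×3]→L[ℝ] EuclideanSpace ℝ (Fin 3))) × (EuclideanSpace ℝ (Fin 3) × (EuclideanSpace ℝ (Fin 3) [×1]→L[ℝ] EuclideanSpace ℝ (Fin 3)) × (EuclideanSpace ℝ (Fin 3) [×2]→L[ℝ] EuclideanSpace ℝ (Fin 3)) × (EuclideanSpace ℝ (Fin 3) [×3]→L[ℝ] EuclideanSpace ℝ (Fin 3))) → EuclideanSpace ℝ (Fin 3))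
        (v b : EuclideanSpace ℝ (Fin 3) → EuclideanSpace ℝ (Fin 3)),
        ContDiff ℝ (⊤ : ℕ∞) m → ContDiff ℝ (⊤ : ℕ∞) σ → ContDiff ℝ (⊤ : ℕ∞) Φ → (∀ z, 0 ≤ σ z) →
        Literature.Analysis.FluidPDE.IsSchwartzField v → ContDiff ℝ (⊤ : ℕ∞) b →
        (∃ C : ℝ, ∀ n : ℕ, n ≤ 4 → ∀ x : EuclideanSpace ℝ (Fin 3), (1 + ‖x‖) ^ 4 * ‖iteratedFDeriv ℝ n b x‖ ≤ C) →
        (∀ x, -(fderiv ℝ m (J v x) (J b x)) = σ (J4 v x, J4 b x) + Literature.Analysis.FluidPDE.VectorCalculus.divergence (fun y => Φ (J v y, J b y)) x) →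
        MeasureTheory.Integrable (fun x => σ (J4 v x, J4 b x)) ∧
          -∫ x, fderiv ℝ m (J v x) (J b x) = ∫ x, σ (J4 v x, J4 b x) := by
  intro J J4 hJ _hJ4 m σ Φ v b hm _hσ hΦ _hσ0 hv hb hdec hid
  obtain ⟨C, hC⟩ := hdec
  obtain ⟨f, rfl⟩ := hv
  -- Schwartz decay of the derivatives of `v = ⇑f` of order `≤ 4` with weight `(1+|x|)⁴`
  obtain ⟨S, hS⟩ : ∃ S : ℝ, ∀ n : ℕ, n ≤ 4 → ∀ x : EuclideanSpace ℝ (Fin 3),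
      (1 + ‖x‖) ^ 4 * ‖iteratedFDeriv ℝ n (⇑f) x‖ ≤ S :=
    ⟨_, fun n hn x => SchwartzMap.one_add_le_sup_seminorm_apply (𝕜 := ℝ) (m := (4, 4)) le_rfl hn f x⟩
  have hvs : ContDiff ℝ (⊤ : ℕ∞) (⇑f) := f.smooth ⊤
  -- the jet spaces are finite-dimensional (hence proper)
  have _i1 := StubFluxTransfer.finiteDimensional_continuousMultilinearMap 1
  have _i2 := StubFluxTransfer.finiteDimensional_continuousMultilinearMap 2
  have _i3 := StubFluxTransfer.finiteDimensional_continuousMultilinearMap 3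
  -- jet bounds for `v` and `b`, transferred to `J v`, `J b`
  obtain ⟨hv1, hvJ, hvD⟩ := StubFluxTransfer.jet_bounds hvs hS
  obtain ⟨hb1, hbJ, hbD⟩ := StubFluxTransfer.jet_bounds hb hC
  have eJ : ∀ u : EuclideanSpace ℝ (Fin 3) → EuclideanSpace ℝ (Fin 3),
      J u = fun x => (u x, iteratedFDeriv ℝ 1 u x, iteratedFDeriv ℝ 2 u x, iteratedFDeriv ℝ 3 u x) :=
    fun u => funext (hJ u)
  have hv1' : ContDiff ℝ 1 (J ⇑f) := by rw [eJ]; exact hv1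
  have hb1' : ContDiff ℝ 1 (J b) := by rw [eJ]; exact hb1
  have hvJ' : ∀ x, ‖J (⇑f) x‖ ≤ S * ((1 + ‖x‖) ^ 4)⁻¹ := fun x => by rw [hJ]; exact hvJ x
  have hbJ' : ∀ x, ‖J b x‖ ≤ C * ((1 + ‖x‖) ^ 4)⁻¹ := fun x => by rw [hJ]; exact hbJ x
  have hvD' : ∀ x, ‖fderiv ℝ (J ⇑f) x‖ ≤ S * ((1 + ‖x‖) ^ 4)⁻¹ := by rw [eJ]; exact hvD
  have hbD' : ∀ x, ‖fderiv ℝ (J b) x‖ ≤ C * ((1 + ‖x‖) ^ 4)⁻¹ := by rw [eJ]; exact hbD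
  -- the pair of jets `g = (J v, J b)`, with constant `max S C`
  have hg : ContDiff ℝ 1 fun y => (J (⇑f) y, J b y) := hv1'.prodMk hb1'
  have hg0 : ∀ x, ‖(J (⇑f) x, J b x)‖ ≤ max S C * ((1 + ‖x‖) ^ 4)⁻¹ := fun x => by
    have hρ : 0 ≤ ((1 + ‖x‖) ^ 4)⁻¹ := by positivity
    rw [Prod.norm_mk]
    exact max_le ((hvJ' x).trans (mul_le_mul_of_nonneg_right (le_max_left _ _) hρ))
      ((hbJ' x).trans (mul_le_mul_of_nonneg_right (le_max_right _ _) hρ))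
  have hg1 : ∀ x, ‖fderiv ℝ (fun y => (J (⇑f) y, J b y)) x‖ ≤ max S C * ((1 + ‖x‖) ^ 4)⁻¹ := by
    intro x
    have hρ : 0 ≤ ((1 + ‖x‖) ^ 4)⁻¹ := by positivity
    rw [DifferentiableAt.fderiv_prodMk (hv1'.differentiable one_ne_zero x)
      (hb1'.differentiable one_ne_zero x), ContinuousLinearMap.opNorm_prod, Prod.norm_mk]
    exact max_le ((hvD' x).trans (mul_le_mul_of_nonneg_right (le_max_left _ _) hρ))
      ((hbD' x).trans (mul_le_mul_of_nonneg_right (le_max_right _ _) hρ))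
  -- integrability of the pairing and of the divergence term, and `∫ div = 0`
  have hFint : MeasureTheory.Integrable fun x => fderiv ℝ m (J (⇑f) x) (J b x) :=
    StubFluxTransfer.integrable_pairing hv1'.continuous hb1'.continuous hvJ' hbJ'
      (hm.of_le (by exact_mod_cast le_top))
  obtain ⟨hDint, hD0⟩ :=
    StubFluxTransfer.flux hg hg0 hg1 (Φ := Φ) (hΦ.of_le (by exact_mod_cast le_top))
  -- the `σ`-term is the difference of two integrable functions
  have hσeq : (fun x => σ (J4 (⇑f) x, J4 b x)) = fun x => -(fderiv ℝ m (J (⇑f) x) (J b x)) -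
      Literature.Analysis.FluidPDE.VectorCalculus.divergence (fun y => Φ (J (⇑f) y, J b y)) x := by
    funext x
    linarith [hid x]
  have hσint : MeasureTheory.Integrable fun x => σ (J4 (⇑f) x, J4 b x) := by
    rw [hσeq]
    exact hFint.fun_neg.sub' hDint
  refine ⟨hσint, ?_⟩
  -- integrate the pointwise identity
  have hI : ∫ x, -(fderiv ℝ m (J (⇑f) x) (J b x)) = ∫ x, (σ (J4 (⇑f) x, J4 b x) +
      Literature.Analysis.FluidPDE.VectorCalculus.divergence (fun y => Φ (J (⇑f) y, J b y)) x) :=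
    integral_congr_ae (Filter.Eventually.of_forall hid)
  rw [integral_neg, integral_add hσint hDint, hD0, add_zero] at hI
  exact hI

end Summit.NavierStokesRegularity.NavierStokesRegularity.Theorems

end
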